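import Literature.Analysis.OperatorTheory.GaussianTransferKernelSupersolutionFrame
import HarnessLib

/-!
# The harmonic transfer kernel in an orthonormal frame, SPLIT over a window of modes: exact Gaussian factor on the window × an explicit
# slow-mode kernel integral against an arbitrary slow weight (Born–Oppenheimer factorisation)
# (companion of `GaussianTransferKernelSupersolutionFrame`; topic `Literature/Analysis/OperatorTheory`)

For an orthonormal frame `(eᵢ)_{i∈ι}` of a finite-dimensional real inner-product space `V`, a decidable window `p : ι → Prop` (the "stiff" modes
`W = {i | p i}`, the "slow" modes its complement), exponents `aᵢ ≥ 0`, `b > 0`, window exponents `c'ⱼ ≥ 0` (`j ∈ W`) and ANY function `g` of the slow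
coordinates:
`∫ e^{−Σaᵢ⟪eᵢ,x⟫²} e^{−b‖x−y‖²} e^{−Σaᵢ⟪eᵢ,y⟫²} · e^{−Σ_{j∈W} c'ⱼ⟪eⱼ,y⟫²} · g((⟪eⱼ,y⟫)_{j∉W}) dy`
`  = [Π_{j∈W} √(π/s'ⱼ) · e^{−Σ_W κⱼ⟪eⱼ,x⟫²} · e^{−Σ_W c'ⱼ⟪eⱼ,x⟫²}] · ∫_{slow} e^{−Σ_{j∉W} aⱼ⟪eⱼ,x⟫²} e^{−bΣ_{j∉W}(⟪eⱼ,x⟫−wⱼ)²} e^{−Σ_{j∉W} aⱼwⱼ²} g(w) dw`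
(`s'ⱼ = aⱼ + b + c'ⱼ`, `κⱼ = (aⱼ² + 2aⱼb − c'ⱼ²)/s'ⱼ`; `integral_gaussKernel_mul_gaussian_window`).  The tool: in frame coordinates the Lebesgue measure
of `V` is the product of the window and slow coordinate measures (`integral_frame_mul_split`, from Mathlib's `measurePreserving_piEquivPiSubtypeProd` and
`integral_prod_mul`).  Use (lattice Yang–Mills, COARSE lanes of S-BASE): `W` = nonzero-momentum modes (closed form, with the super-solution gain of the
fattened weight), slow = the nine constant modes carrying the one-site model, `g` = a one-site weight.
Source: A. Wipf, *Statistical Approach to Quantum Field Theory*, LNP 992 (2021) §8.5.1–8.5.2 (harmonic transfer kernel by normal modes); the splitting is folklore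
(Fubini in an orthonormal frame).  No definitions, no named facts, 0 sorry.
-/

noncomputable section

open MeasureTheory Real
open scoped RealInnerProductSpace

namespace Literature.Analysis.OperatorTheory.GaussianTransferKernel

variable {V : Type*} [NormedAddCommGroup V] [InnerProductSpace ℝ V] [FiniteDimensional ℝ V]
  [MeasurableSpace V] [BorelSpace V]
variable {ι : Type*} [Fintype ι]

/-- The coordinate map of an orthonormal frame as a volume-preserving measurable equivalence `V ≃ᵐ (ι → ℝ)` (re-derived; the copies in the sibling
files are private). [folklore] -/
private theorem exists_coord'' (e : OrthonormalBasis ι ℝ V) :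
    ∃ Ψ : V ≃ᵐ (ι → ℝ), MeasurePreserving Ψ volume volume ∧ ∀ x i, Ψ x i = ⟪e i, x⟫ := by
  refine ⟨e.measurableEquiv.trans (MeasurableEquiv.toLp 2 (ι → ℝ)).symm,
    (e.measurePreserving_measurableEquiv).trans (EuclideanSpace.volume_preserving_symm_measurableEquiv_toLp ι), fun x i => ?_⟩
  simp only [MeasurableEquiv.trans_apply]
  show (MeasurableEquiv.toLp 2 (ι → ℝ)).symm (e.repr x) i = ⟪e i, x⟫
  rw [← e.repr_apply_apply]
  rfl

/-! ## §1 Fubini in a frame: window × slow coordinates -/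

/-- ★ **Frame Fubini** (the normal-mode factorisation of configuration-space integrals): a function of the window coordinates times a function of the
complementary coordinates integrates to the product of the two coordinate integrals. [cite: Wipf2021, §8.5.2 (8.64)–(8.67)] -/
theorem integral_frame_mul_split (e : OrthonormalBasis ι ℝ V) (p : ι → Prop) [DecidablePred p] (F : ({i // p i} → ℝ) → ℝ)
    (G : ({i // ¬p i} → ℝ) → ℝ) :
    ∫ y, F (fun j => ⟪e (j : ι), y⟫) * G (fun j => ⟪e (j : ι), y⟫) = (∫ u : {i // p i} → ℝ, F u) * ∫ w : {i // ¬p i} → ℝ, G w := by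
  obtain ⟨Ψ, hΨ, hΨe⟩ := exists_coord'' e
  have hpt : ∀ y, F (fun j => ⟪e (j : ι), y⟫) * G (fun j => ⟪e (j : ι), y⟫) =
      (fun z : ι → ℝ => F (fun j => z j) * G (fun j => z j)) (Ψ y) := fun y => by simp only [hΨe]
  simp_rw [hpt]
  rw [hΨ.integral_comp Ψ.measurableEmbedding (g := fun z : ι → ℝ => F (fun j => z j) * G (fun j => z j))]
  have hσ := volume_preserving_piEquivPiSubtypeProd (fun _ : ι => ℝ) p
  have hpt' : ∀ z : ι → ℝ, F (fun j => z j) * G (fun j => z j) =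
      (fun q : ({i // p i} → ℝ) × ({i // ¬p i} → ℝ) => F q.1 * G q.2) (MeasurableEquiv.piEquivPiSubtypeProd (fun _ : ι => ℝ) p z) := fun z => rfl
  simp_rw [hpt']
  rw [hσ.integral_comp (MeasurableEquiv.piEquivPiSubtypeProd (fun _ : ι => ℝ) p).measurableEmbedding
    (g := fun q : ({i // p i} → ℝ) × ({i // ¬p i} → ℝ) => F q.1 * G q.2)]
  exact integral_prod_mul (μ := volume) (ν := volume) F G

/-! ## §2 The windowed harmonic kernel against a window Gaussian and a slow weight -/

omit [FiniteDimensional ℝ V] [MeasurableSpace V] [BorelSpace V] in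
/-- Splitting the kernel's exponents over the window: `Σᵢ fᵢ = Σ_{p} f + Σ_{¬p} f` for the three quadratic sums. [folklore] -/
private theorem kernel_split (e : OrthonormalBasis ι ℝ V) (p : ι → Prop) [DecidablePred p] (a : ι → ℝ) (b : ℝ) (x y : V) :
    Real.exp (-(∑ i, a i * ⟪e i, x⟫ ^ 2)) * Real.exp (-(b * ‖x - y‖ ^ 2)) * Real.exp (-(∑ i, a i * ⟪e i, y⟫ ^ 2)) =
      (Real.exp (-(∑ j : {i // p i}, a j * ⟪e (j : ι), x⟫ ^ 2)) * Real.exp (-(b * ∑ j : {i // p i}, (⟪e (j : ι), x⟫ - ⟪e (j : ι), y⟫) ^ 2)) *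
          Real.exp (-(∑ j : {i // p i}, a j * ⟪e (j : ι), y⟫ ^ 2))) *
        (Real.exp (-(∑ j : {i // ¬p i}, a j * ⟪e (j : ι), x⟫ ^ 2)) * Real.exp (-(b * ∑ j : {i // ¬p i}, (⟪e (j : ι), x⟫ - ⟪e (j : ι), y⟫) ^ 2)) *
          Real.exp (-(∑ j : {i // ¬p i}, a j * ⟪e (j : ι), y⟫ ^ 2))) := by
  have hn : ‖x - y‖ ^ 2 = ∑ i, (⟪e i, x⟫ - ⟪e i, y⟫) ^ 2 := by
    rw [← e.sum_sq_inner_right (x - y)]; simp only [inner_sub_right]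
  rw [hn, ← Fintype.sum_subtype_add_sum_subtype p (fun i => a i * ⟪e i, x⟫ ^ 2),
    ← Fintype.sum_subtype_add_sum_subtype p (fun i => (⟪e i, x⟫ - ⟪e i, y⟫) ^ 2),
    ← Fintype.sum_subtype_add_sum_subtype p (fun i => a i * ⟪e i, y⟫ ^ 2)]
  simp only [neg_add, mul_add, Real.exp_add]
  ring

/-- ★★ **WINDOWED HARMONIC STEP (Born–Oppenheimer factorisation)**: for `aᵢ ≥ 0`, `b > 0`, window exponents `c'ⱼ ≥ 0` and any slow weight `g`,
`∫ e^{−Σa⟪e,x⟫²}e^{−b‖x−y‖²}e^{−Σa⟪e,y⟫²} · e^{−Σ_W c'ⱼ⟪eⱼ,y⟫²} · g(slow(y)) dy = [Π_W √(π/s'ⱼ) · e^{−Σ_W κⱼ⟪eⱼ,x⟫²} · e^{−Σ_W c'ⱼ⟪eⱼ,x⟫²}] ·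
∫_slow e^{−Σ_{¬p} aⱼ⟪eⱼ,x⟫²} e^{−bΣ_{¬p}(⟪eⱼ,x⟫−wⱼ)²} e^{−Σ_{¬p} aⱼwⱼ²} g(w) dw`. [cite: Wipf2021, §8.5.2 (8.64)–(8.67)] -/
theorem integral_gaussKernel_mul_gaussian_window (e : OrthonormalBasis ι ℝ V) (p : ι → Prop) [DecidablePred p] {a : ι → ℝ}
    {c' : {i // p i} → ℝ} {b : ℝ} (ha : ∀ i, 0 ≤ a i) (hb : 0 < b) (hc' : ∀ j, 0 ≤ c' j) (g : ({i // ¬p i} → ℝ) → ℝ) (x : V) :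
    ∫ y, Real.exp (-(∑ i, a i * ⟪e i, x⟫ ^ 2)) * Real.exp (-(b * ‖x - y‖ ^ 2)) * Real.exp (-(∑ i, a i * ⟪e i, y⟫ ^ 2)) *
        (Real.exp (-(∑ j : {i // p i}, c' j * ⟪e (j : ι), y⟫ ^ 2)) * g (fun j : {i // ¬p i} => ⟪e (j : ι), y⟫)) =
      ((∏ j : {i // p i}, Real.sqrt (π / (a j + b + c' j))) *
          Real.exp (-(∑ j : {i // p i}, (a j ^ 2 + 2 * a j * b - c' j ^ 2) / (a j + b + c' j) * ⟪e (j : ι), x⟫ ^ 2)) *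
          Real.exp (-(∑ j : {i // p i}, c' j * ⟪e (j : ι), x⟫ ^ 2))) *
        ∫ w : {i // ¬p i} → ℝ, Real.exp (-(∑ j : {i // ¬p i}, a j * ⟪e (j : ι), x⟫ ^ 2)) *
          Real.exp (-(b * ∑ j : {i // ¬p i}, (⟪e (j : ι), x⟫ - w j) ^ 2)) * Real.exp (-(∑ j : {i // ¬p i}, a j * w j ^ 2)) * g w := by
  -- window factor `F` and slow factor `G` as functions of the coordinates
  set F : ({i // p i} → ℝ) → ℝ := fun u =>
    Real.exp (-(∑ j : {i // p i}, a j * ⟪e (j : ι), x⟫ ^ 2)) * Real.exp (-(b * ∑ j : {i // p i}, (⟪e (j : ι), x⟫ - u j) ^ 2)) *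
      Real.exp (-(∑ j : {i // p i}, a j * u j ^ 2)) * Real.exp (-(∑ j : {i // p i}, c' j * u j ^ 2)) with hF
  set G : ({i // ¬p i} → ℝ) → ℝ := fun w =>
    Real.exp (-(∑ j : {i // ¬p i}, a j * ⟪e (j : ι), x⟫ ^ 2)) * Real.exp (-(b * ∑ j : {i // ¬p i}, (⟪e (j : ι), x⟫ - w j) ^ 2)) *
      Real.exp (-(∑ j : {i // ¬p i}, a j * w j ^ 2)) * g w with hG
  have hpt : ∀ y, Real.exp (-(∑ i, a i * ⟪e i, x⟫ ^ 2)) * Real.exp (-(b * ‖x - y‖ ^ 2)) * Real.exp (-(∑ i, a i * ⟪e i, y⟫ ^ 2)) *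
      (Real.exp (-(∑ j : {i // p i}, c' j * ⟪e (j : ι), y⟫ ^ 2)) * g (fun j : {i // ¬p i} => ⟪e (j : ι), y⟫)) =
      F (fun j => ⟪e (j : ι), y⟫) * G (fun j => ⟪e (j : ι), y⟫) := fun y => by
    rw [kernel_split e p a b x y, hF, hG]
    ring
  simp_rw [hpt]
  rw [integral_frame_mul_split e p F G, hF,
    integral_gaussKernel_mul_gaussian_pi (ι := {i // p i}) (fun j => ha j) hb hc' (fun j : {i // p i} => ⟪e (j : ι), x⟫)]

/-- The all-window case (`p = ⊤`-like: every slow weight is a constant) is consistent with `integral_gaussKernel_mul_gaussian_frame`; the empty window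
leaves the plain kernel against `g`. (Sanity restatement of the slow factor alone: with no window exponents the formula is Fubini only.)
[cite: Wipf2021, §8.5.2 (8.64)–(8.67)] -/
theorem integral_gaussKernel_mul_slow (e : OrthonormalBasis ι ℝ V) (p : ι → Prop) [DecidablePred p] {a : ι → ℝ} {b : ℝ}
    (ha : ∀ i, 0 ≤ a i) (hb : 0 < b) (g : ({i // ¬p i} → ℝ) → ℝ) (x : V) :
    ∫ y, Real.exp (-(∑ i, a i * ⟪e i, x⟫ ^ 2)) * Real.exp (-(b * ‖x - y‖ ^ 2)) * Real.exp (-(∑ i, a i * ⟪e i, y⟫ ^ 2)) *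
        g (fun j : {i // ¬p i} => ⟪e (j : ι), y⟫) =
      ((∏ j : {i // p i}, Real.sqrt (π / (a j + b))) *
          Real.exp (-(∑ j : {i // p i}, (a j ^ 2 + 2 * a j * b) / (a j + b) * ⟪e (j : ι), x⟫ ^ 2))) *
        ∫ w : {i // ¬p i} → ℝ, Real.exp (-(∑ j : {i // ¬p i}, a j * ⟪e (j : ι), x⟫ ^ 2)) *
          Real.exp (-(b * ∑ j : {i // ¬p i}, (⟪e (j : ι), x⟫ - w j) ^ 2)) * Real.exp (-(∑ j : {i // ¬p i}, a j * w j ^ 2)) * g w := by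
  have h := integral_gaussKernel_mul_gaussian_window e p (c' := fun _ => 0) ha hb (fun _ => le_rfl) g x
  simp only [zero_mul, Finset.sum_const_zero, neg_zero, Real.exp_zero, one_mul, add_zero, mul_one, sub_zero,
    zero_pow two_ne_zero] at h
  simpa using h

end Literature.Analysis.OperatorTheory.GaussianTransferKernel

end
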